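import Summits.QuantumAdvantage.QuantumAdvantage.Theses.CubicForrelation
import Literature.Computability.QuantumComplexity.SignedCubicForrelation
import Literature.Computability.QuantumComplexity.ForrelationDerivativeTables
import Literature.Computability.Complexity.PromiseZPPProofs
import Literature.Computability.Cryptography.LatticeOWF
import Literature.Computability.QuantumComplexity.PromiseBQPSubsetPromisePP
import Literature.Computability.QuantumComplexity.ForrelationDirectSum
import Summits.QuantumAdvantage.QuantumAdvantage.Theorems.SignedCubicForrelationInPrBPP.Negative.CrossCorrelation
import Summits.QuantumAdvantage.QuantumAdvantage.Theorems.SignedCubicForrelationInPrBPP.Negative.GoldCube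

/-!
# Disproof of `SignedCubicForrelationInPrBPP` — findings (cdisprove seat, stmt-QuantumAdvantage-13933)

Crux `S := SignedCubicForrelationInPrBPP` (route `QuantumAdvantage/CubicForrelation`, rank 7):
signed cubic 2-fold Forrelation (`k = 2`, `n` even, both circuits computing functions of
𝔽₂-degree `≤ 3`; YES `Φ ≥ 3/5`, NO `Φ ≤ -3/5`) is in textbook `PromiseBPP'`.
By `rfl` it is `signedCubicForrelationProblem 2 ∈ PromiseBPP'` (`crux_eq`), and it is LITERALLY the
negation of the route target `X := SignedCubicForrelationNotPrBPP` (`crux_iff_not_target`).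

## Findings (index; every claim below is a checked theorem unless marked `sorry`)

* §1 BARRIER — a disproof of `S` is the route's thesis `X`, i.e. an explicit `PromiseBQP`-problem
  outside `PromiseBPP'` (given the support item `SignedCubicForrelationMemPromiseBQP`, AA18 Prop. 6):
  `not_crux_imp_promise_separation`; with the promise form of Adleman–DeMarrais–Huang
  `PromiseBQP ⊆ promiseLift PP` (LANDED by this seat, p71952,
  `Literature/Computability/QuantumComplexity/PromiseBQPSubsetPromisePP.lean`) it gives `P ≠ PP`
  UNCONDITIONALLY in the tree's classes (`not_crux_imp_P_ne_PP`), and with `PlLift` the summit itself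
  (`not_crux_imp_summit`) — hence
  `PP ⊄ BPP`, `P ≠ PSPACE` by `Literature.Barriers.QuantumAdvantage.SeparationPrerequisites`.
  So `S` cannot be killed by this seat short of a breakthrough; it can only be PROVED (which kills
  the route's S-assembly) or left open. No formal glitch: promise disjoint and inhabited on both
  sides (tree: `signedCubicForrelationProblem_disjoint`, `encode_andPairInstance…`), `uniformProb`
  genuine, `Classes.P` textbook, thresholds real literals.
* §2 LOAD-BEARING ANALYSIS — every hypothesis of the promise (even `n`, degree `≤ 3`, threshold
  `3/5`, the class `PromiseBPP'`) can only be dropped towards a STRONGER membership claim whose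
  negation is again a separation, so no `_false_without_` theorem exists for this crux; what is
  provable is the lattice of implications `CruxWithout… → S` (`crux_of_withoutEven`,
  `crux_of_withoutDeg`, `crux_of_threshold`, `crux_of_strong`, `crux_of_derandomised`), the
  symmetry `S ↔ swap` (`crux_iff_swap`) and the downward kill `S → ¬ r3`
  (`crux_imp_not_signedExact`: proving `S` also refutes `SignedExactCubicForrelationNotPrBPP`).
  §2b (LANDED p72099, `ForrelationDirectSum.lean`): `Φ` is multiplicative under direct sums — the signed
  EXACT slice is XOR-closed (signs multiply: `exact_signs_multiply`), the `±3/5` thresholds are not.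
* §3 NATURAL STRENGTHENINGS / PROOF-SHAPE LEMMAS REFUTED (finite models):
  - §3a `no_negAt_invariant_decider`: no statistic invariant under complementing the second
    circuit separates YES from NO (witness `andPairInstance`, `Φ = 1`, vs its `negAt 1`, `Φ = -1`);
    in particular the derivative Walsh tables of the landed `Φ²` estimator
    (`DerivativeWalsh.dwt_signOf_not`) — the expected proof MUST add a sign-sensitive step.
  - §3b `not_biquadraticPermsHaveAffineComponent`: the route text names as "the one theorem that
    kills the signed line" the claim that every quadratic permutation of 𝔽₂^m with quadratic
    inverse is triangularisable up to affine equivalence (then the MM peel always starts). FALSE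
    already at `m = 3`: the Gold cube `x ↦ x³` on 𝔽₈ (inverse `x ↦ x⁵`, both quadratic) has NO
    non-zero affine component `ℓ ∘ π` (LANDED in the tree's `IsDegLeFun` vocabulary, p71811,
    `Theorems/SignedCubicForrelationInPrBPP/Negative/GoldCube.lean`:
    `exists_biquadratic_perm_without_affine_component`), whereas the first coordinate of any triangular
    map `τ_i(x) = x_i + q_i(x_{<i})` is affine and affine equivalence transports it to an affine
    component of `π`. (Caveat: direct sums of Gold cubes are decomposable, so this refutes the universal
    peeling LEMMA, not `S`; the census of biquadratic permutations for `m ≤ 4` is kit job j007503.)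
  - §3c cross-correlation identity (NEW, LANDED p71730,
    `Theorems/SignedCubicForrelationInPrBPP/Negative/CrossCorrelation.lean`): for an exact pair
    `S(f,g)·⟨f,g'⟩ = 2ⁿ·S(g',g)` for EVERY test function `g'` — the sign transports along any
    noticeable correlation (`sign_transport`), the partner is replaceable, and every exact pair one of
    whose halves has a quadratic approximant of constant correlation is classically easy (Tulsiani–Wolf +
    sampling): hardness of the sign, if any, lives where BOTH halves have second-order nonlinearity
    `2^{n-1}(1-o(1))`.
  - §3d (prose) CONSTRAINTS ON A HARD FAMILY for `X` (equivalently: where a proof of `S` must work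
    hardest) collected from §3a–§3c and the sibling disproofs; and the cautionary analogy with broken
    "hidden algebraic structure" proofs of quantumness (Kahanamoku-Meyer arXiv:1912.05547,
    Gross–Hangleiter arXiv:2312.10156); PAPER ANALYSIS (R)/(Z): `Rad T_b = AffComp(π) ⊕ LS(π)∩…`, and `𝒜 = 0 ⟹
    Rad T_a ⊇ C_b ≠ 0` — the killer "(β) with 𝒜 = 0 and trivial radicals" cannot exist; live regime = nondegenerate `π`.
  - §3e SMALL MODELS / COMPUTATIONS / LITERATURE CENSUS: n = 4 exhaustive value set `{5/8, 3/4, 1}`; PP20 duals; the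
    Λ²-linearisation of the hidden split is rank `≤ 12` (filter, not solver); biquadratic permutations: none nondegenerate
    at m = 5 (ToSC 2017), m = 6 has 70 biquadratic classes of 2 263 (ToSC 2019; list wanted acq-05758).
* §4 TARGETS — line `polar-radical-seeds` PICKED: heredity/dualValue/certify/passThrough TRUE on paper, safeMM closed,
  finder + residue OPEN (unrefutable); composition sorry-free; `stub_residue` NOT vacuous (P₄ ∈ residue, PROVED:
  `Negative/ResidueNonempty.lean`, p84971); killer instances for the finder = nondegenerate biquadratic `π` (§3d–e).
* §5 NEAR-MISS — `crux_refuted : ¬ S` is `sorry`: obstruction = §1.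

Provers of `S`: the sign bit on an exact pair is `c = a(0) ⊕ b̃(0)`, the sign of ONE Walsh
coefficient of a cubic bent function whose dual is known up to complement; §3a says your decider
must break the `b ↦ b ⊕ 1` symmetry explicitly, §3b says "triangularise π then peel" is not total.
-/

set_option linter.dupNamespace false

namespace Summit.QuantumAdvantage.QuantumAdvantage.Cruxes.SignedCubicForrelationInPrBPP.Disproof

open Literature.Computability.Complexity Literature.Computability.Cryptography
open Literature.Computability.QuantumComplexity
open Summit.QuantumAdvantage.QuantumAdvantage.Theses.CubicForrelation

/-! ### §0 The crux by name -/

/-- The crux is, by `rfl`, membership of the tree's `signedCubicForrelationProblem 2`. -/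
theorem crux_eq :
    SignedCubicForrelationInPrBPP = (signedCubicForrelationProblem 2 ∈ PromiseBPP') := rfl

/-- The crux is literally the negation of the route target `X`. -/
theorem crux_iff_not_target : SignedCubicForrelationInPrBPP ↔ ¬ SignedCubicForrelationNotPrBPP :=
  not_not.symm

/-- … and a disproof of the crux IS the route target. -/
theorem not_crux_iff_target : ¬ SignedCubicForrelationInPrBPP ↔ SignedCubicForrelationNotPrBPP :=
  Iff.rfl

/-! ### §1 Barrier: any disproof is an explicit promise separation -/

/-- A disproof of the crux, together with the support item `SignedCubicForrelationMemPromiseBQP`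
(AA18 §3.2 Prop. 6, the Hadamard test: acceptance exactly `(1+Φ)/2`), separates `PromiseBQP` from
`PromiseBPP'`. -/
theorem not_crux_imp_promise_separation (h34 : SignedCubicForrelationMemPromiseBQP)
    (h : ¬ SignedCubicForrelationInPrBPP) : ¬ (PromiseBQP ⊆ PromiseBPP') :=
  fun hsub => h (hsub h34)

/-- … hence `P ≠ PP` in the tree's classes: the promise form of Adleman–DeMarrais–Huang
`PromiseBQP ⊆ promiseLift PP` (landed by this seat: `PromiseBQP_subset_promiseLift_PP`, p71952) puts the
signed problem in `promiseLift PP`, and `P = PP` would make that `PromiseP ⊆ PromiseBPP'`. This is the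
`SeparationPrerequisites` barrier at promise level, now a theorem rather than a gloss. -/
theorem not_crux_imp_P_ne_PP (h34 : SignedCubicForrelationMemPromiseBQP)
    (h : ¬ SignedCubicForrelationInPrBPP) : Classes.P ≠ PP :=
  P_ne_PP_of_promise_witness h34 h

/-- … and, granted `PlLift`, the summit `QuantumAdvantage` (the route's deciding theorem), whence
`PP ⊄ BPP`, `P ≠ PP`, `P ≠ P^{#P}`, `P ≠ PSPACE` by
`Literature.Barriers.QuantumAdvantage.SeparationPrerequisites`. -/
theorem not_crux_imp_summit (h₁ : PlLift) (h34 : SignedCubicForrelationMemPromiseBQP)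
    (h : ¬ SignedCubicForrelationInPrBPP) : _root_.QuantumAdvantage := by
  -- buildfix 2026-08-19: the route's `closes` was re-cut to (NearExactIsExact, SignedExactSliceIsLift,
  -- SignedExactCubicForrelationNotPrBPP); this is the landed `Theorems.CubicForrelation.Assembly_proof`
  -- script for the PlLift assembly, inlined (statement unchanged).
  by_contra hQA
  refine h (h₁ ?_ h34)
  intro L hL
  by_contra hLn
  exact hQA ⟨L, hL, hLn⟩

/-! ### §2 Load-bearing analysis (monotonicity form)

Each "hypothesis" of the crux is a restriction of the promise or the choice of the class. Dropping
it yields a STRONGER membership claim; the implications below are the provable content ("a proof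
of the stronger claim proves `S`"); the converse non-implications would be separations. -/

/-- Drop `Even n`: signed cubic 2-fold Forrelation on any number of input bits. -/
def CruxWithoutEven : Prop :=
  (⟨KForrelationInstance.encode '' {I | I.IsYes ∧ I.k = 2 ∧ ∀ i, IsDegLeFun 3 (I.C i).eval},
    KForrelationInstance.encode ''
      {I | (I.IsOverB2 ∧ I.value ≤ -(3 / 5 : ℝ)) ∧ I.k = 2 ∧ ∀ i, IsDegLeFun 3 (I.C i).eval}⟩ :
    PromiseProblem) ∈ PromiseBPP'

/-- Drop the degree bound: signed 2-fold Forrelation for arbitrary `B₂`-circuits (`n` even). -/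
def CruxWithoutDeg : Prop :=
  (⟨KForrelationInstance.encode '' {I | I.IsYes ∧ I.k = 2 ∧ Even I.n},
    KForrelationInstance.encode '' {I | (I.IsOverB2 ∧ I.value ≤ -(3 / 5 : ℝ)) ∧ I.k = 2 ∧ Even I.n}⟩ :
    PromiseProblem) ∈ PromiseBPP'

/-- Lower the threshold to `t` (YES `Φ ≥ t`, NO `Φ ≤ -t`). -/
def CruxAtThreshold (t : ℝ) : Prop :=
  (⟨KForrelationInstance.encode ''
      {I | (I.IsOverB2 ∧ t ≤ I.value) ∧ I.k = 2 ∧ Even I.n ∧ ∀ i, IsDegLeFun 3 (I.C i).eval},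
    KForrelationInstance.encode ''
      {I | (I.IsOverB2 ∧ I.value ≤ -t) ∧ I.k = 2 ∧ Even I.n ∧ ∀ i, IsDegLeFun 3 (I.C i).eval}⟩ :
    PromiseProblem) ∈ PromiseBPP'

/-- Strengthen the class to the strong lift `PromiseBPP = promiseLift BPP` (gap on ALL inputs). -/
def CruxStrong : Prop := signedCubicForrelationProblem 2 ∈ PromiseBPP

/-- Strengthen the class to `PromiseP` (a deterministic decider). -/
def CruxDerandomised : Prop := signedCubicForrelationProblem 2 ∈ PromiseP

/-- `S` follows from the version without the parity restriction (sub-promise). -/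
theorem crux_of_withoutEven (h : CruxWithoutEven) : SignedCubicForrelationInPrBPP := by
  refine mem_PromiseBPP'_of_subset ?_ ?_ h
  · exact Set.image_mono fun I hI => ⟨hI.1, hI.2.1, hI.2.2.2⟩
  · exact Set.image_mono fun I hI => ⟨hI.1, hI.2.1, hI.2.2.2⟩

/-- `S` follows from the version without the degree restriction (sub-promise). -/
theorem crux_of_withoutDeg (h : CruxWithoutDeg) : SignedCubicForrelationInPrBPP := by
  refine mem_PromiseBPP'_of_subset ?_ ?_ h
  · exact Set.image_mono fun I hI => ⟨hI.1, hI.2.1, hI.2.2.1⟩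
  · exact Set.image_mono fun I hI => ⟨hI.1, hI.2.1, hI.2.2.1⟩

/-- The threshold family is antitone: a decider at threshold `t ≤ 3/5` decides `S`. -/
theorem crux_of_threshold {t : ℝ} (ht : t ≤ 3 / 5) (h : CruxAtThreshold t) :
    SignedCubicForrelationInPrBPP := by
  refine mem_PromiseBPP'_of_subset ?_ ?_ h
  · exact Set.image_mono fun I hI => ⟨⟨hI.1.1, ht.trans hI.1.2⟩, hI.2⟩
  · exact Set.image_mono fun I hI => ⟨⟨hI.1.1, hI.1.2.trans (neg_le_neg ht)⟩, hI.2⟩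

/-- At `t = 3/5` the threshold family is the crux itself. -/
theorem cruxAtThreshold_iff : CruxAtThreshold (3 / 5) ↔ SignedCubicForrelationInPrBPP := Iff.rfl

/-- The strong lift implies the textbook class (`PromiseBPP_subset_PromiseBPP'_holds`). -/
theorem crux_of_strong (h : CruxStrong) : SignedCubicForrelationInPrBPP :=
  PromiseBPP_subset_PromiseBPP'_holds h

/-- A deterministic decider is a randomised one (`PromiseP_subset_PromiseBPP'`). -/
theorem crux_of_derandomised (h : CruxDerandomised) : SignedCubicForrelationInPrBPP :=
  PromiseP_subset_PromiseBPP' h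

/-- Symmetry: `S` is equivalent to membership of the swapped problem (YES `Φ ≤ -3/5`, NO
`Φ ≥ 3/5`) — complement the witness language. -/
theorem crux_iff_swap :
    SignedCubicForrelationInPrBPP ↔ (signedCubicForrelationProblem 2).swap ∈ PromiseBPP' :=
  swap_mem_PromiseBPP'_iff.symm

/-- Downward kill: proving `S` also refutes the route's crux r3
(`SignedExactCubicForrelationNotPrBPP`, the signed EXACT slice), by antitonicity in the promise. -/
theorem crux_imp_not_signedExact (h : SignedCubicForrelationInPrBPP) :
    ¬ SignedExactCubicForrelationNotPrBPP :=
  fun hr3 => signedCubicForrelationProblem_not_mem_PromiseBPP'_of_exact 2 hr3 h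

/-! #### §2b Direct sums: the exact slice is XOR-closed, the thresholds are not

LANDED: `Literature/Computability/QuantumComplexity/ForrelationDirectSum.lean` (p72099) —
`forrelation_directSum : Φ(f₁ ⊕ f₂, g₁ ⊕ g₂) = Φ(f₁,g₁)·Φ(f₂,g₂)`. So exact pairs are closed under `⊕` with
the SIGNS MULTIPLYING (below), i.e. the signed exact problem r3 has the XOR structure of a parity problem
(hardness-amplification / random-self-reduction heuristics apply to it), whereas for the `±3/5` problem `S` a
direct sum of two YES instances with `Φ = 3/5` has `Φ = 9/25 < 3/5` and leaves the promise: the threshold of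
`S` cannot be amplified by padding, consistent with the genuinely monotone family `CruxAtThreshold`. -/

section DirectSum

variable {n₁ n₂ : ℕ}

/-- Signs multiply under direct sum (corollary of the landed `forrelation_directSum_of_exact`). -/
theorem exact_signs_multiply (f₁ g₁ : (Fin n₁ → Bool) → Bool) (f₂ g₂ : (Fin n₂ → Bool) → Bool)
    {ε₁ ε₂ : ℝ} (h₁ : forrelation f₁ g₁ = ε₁) (h₂ : forrelation f₂ g₂ = ε₂) :
    forrelation (n := n₁ + n₂)
        (fun x => xor (f₁ fun i => x (Fin.castAdd n₂ i)) (f₂ fun j => x (Fin.natAdd n₁ j)))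
        (fun y => xor (g₁ fun i => y (Fin.castAdd n₂ i)) (g₂ fun j => y (Fin.natAdd n₁ j))) = ε₁ * ε₂ :=
  forrelation_directSum_of_exact f₁ g₁ f₂ g₂ h₁ h₂

/-- … in particular two YES-instances at the threshold combine to a pair OUTSIDE the promise
(`3/5 · 3/5 = 9/25 < 3/5`). -/
theorem threshold_not_closed_under_directSum : (3 / 5 : ℝ) * (3 / 5) < 3 / 5 := by norm_num

/-- **Gluing an exact pair is free (YES side)**: `Φ(f₁,g₁) ≥ 3/5` and `Φ(f₂,g₂) = 1` give a YES pair on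
`n₁ + n₂` bits with the SAME value. So every fixed in-promise "sporadic block" (P₄ at `625/1024`, the `13/16` and
`15/16` pairs of the 14043 seat, the T-family at `7/8`) generates an infinite in-promise family at constant `Φ`,
and any structure stub of the lines (`stub_flagsFar`, `stub_residue`, `stub_band`) must decide arbitrary bounded
blocks glued to arbitrary exact pairs — it presupposes the exact-pair finder. Conversely, since `Φ` multiplies,
gluing cannot drive a structural defect to infinity INSIDE the promise unless exact pairs of unbounded defect
(non-MM# cubic-dual pairs, `¬ ExactPairsMaioranaMcFarland`-type objects) exist. -/
theorem yes_glue_exact (f₁ g₁ : (Fin n₁ → Bool) → Bool) (f₂ g₂ : (Fin n₂ → Bool) → Bool)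
    (h₁ : (3 / 5 : ℝ) ≤ forrelation f₁ g₁) (h₂ : forrelation f₂ g₂ = 1) :
    (3 / 5 : ℝ) ≤ forrelation (n := n₁ + n₂)
        (fun x => xor (f₁ fun i => x (Fin.castAdd n₂ i)) (f₂ fun j => x (Fin.natAdd n₁ j)))
        (fun y => xor (g₁ fun i => y (Fin.castAdd n₂ i)) (g₂ fun j => y (Fin.natAdd n₁ j))) := by
  rw [forrelation_directSum, h₂, mul_one]; exact h₁

/-- **Gluing an exact pair is free (NO side)**. -/
theorem no_glue_exact (f₁ g₁ : (Fin n₁ → Bool) → Bool) (f₂ g₂ : (Fin n₂ → Bool) → Bool)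
    (h₁ : forrelation f₁ g₁ ≤ -(3 / 5 : ℝ)) (h₂ : forrelation f₂ g₂ = 1) :
    forrelation (n := n₁ + n₂)
        (fun x => xor (f₁ fun i => x (Fin.castAdd n₂ i)) (f₂ fun j => x (Fin.natAdd n₁ j)))
        (fun y => xor (g₁ fun i => y (Fin.castAdd n₂ i)) (g₂ fun j => y (Fin.natAdd n₁ j))) ≤ -(3 / 5 : ℝ) := by
  rw [forrelation_directSum, h₂, mul_one]; exact h₁

end DirectSum

/-! ### §3 Natural strengthenings / proof-shape lemmas refuted in finite models -/

/-! #### §3a No `negAt`-invariant statistic decides the signed problem -/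

/-- **No statistic invariant under complementing the second circuit separates YES from NO.**
Witness: `andPairInstance` (`f = g = x₀x₁`, `Φ = 1`, YES) and `andPairInstance.negAt 1` (`Φ = -1`,
NO) have the same value of any such statistic. The derivative Walsh tables behind the landed `Φ²`
estimator are such a statistic (`DerivativeWalsh.dwt_signOf_not`). -/
theorem no_negAt_invariant_decider {β : Type*} (φ : KForrelationInstance → β)
    (hφ : ∀ I, φ (I.negAt 1) = φ I) :
    ∃ I J : KForrelationInstance, I.encode ∈ (signedCubicForrelationProblem 2).yes ∧
      J.encode ∈ (signedCubicForrelationProblem 2).no ∧ φ I = φ J :=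
  ⟨andPairInstance, andPairInstance.negAt 1,
    signedExactCubicForrelationProblem_yes_subset 2
      encode_andPairInstance_mem_signedExactCubicForrelationProblem_yes,
    signedExactCubicForrelationProblem_no_subset 2
      encode_andPairInstance_negAt_mem_signedExactCubicForrelationProblem_no,
    (hφ _).symm⟩

/-- The derivative Walsh table of the function computed by a circuit is blind to `notCircuit`. -/
theorem dwt_notCircuit {m : ℕ} (C : Circuit (Fin m)) (h u : Fin m → Bool) :
    DerivativeWalsh.dwt (fun y => signOf ((notCircuit C).eval y)) h u =
      DerivativeWalsh.dwt (fun y => signOf (C.eval y)) h u := by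
  simp only [notCircuit_eval]
  exact DerivativeWalsh.dwt_signOf_not _ h u

/-! #### §3b Biquadratic permutations without affine components (the Gold cube on 𝔽₈)

LANDED: `Theorems/SignedCubicForrelationInPrBPP/Negative/GoldCube.lean` (p71811) — `goldCubePerm` (`x ↦ x³`
on `𝔽₈`, inverse `x ↦ x⁵`), `goldCubePerm_isDegLeFun_two`, `goldCubePerm_symm_isDegLeFun_two`,
`goldCubePerm_no_affine_component`, `xor3_of_isDegLeFun_one`, `isDegLeFun_one_of_first_coordinate`,
`exists_biquadratic_perm_without_affine_component`. Here only the natural strengthening and its negation. -/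

section Biquadratic

open Summit.QuantumAdvantage.QuantumAdvantage.Theorems.SignedCubicForrelationInPrBPP.Negative
  (dotB exists_biquadratic_perm_without_affine_component)

/-- NATURAL STRENGTHENING (route text, CHEAPEST FALSIFIER §: "the one theorem that kills [the signed
line]"): every permutation of `𝔽₂^m` that is quadratic with quadratic inverse is triangularisable up to
affine equivalence — weakened to its necessary consequence "has a non-zero affine component `ℓ·π`"
(the first coordinate of a triangular map is affine, `isDegLeFun_one_of_first_coordinate`, and affine
equivalence `A ∘ π ∘ B` transports it: `ℓ :=` row `0` of `A`). -/
def BiquadraticPermsHaveAffineComponent : Prop :=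
  ∀ (m : ℕ) (π : Equiv.Perm (Fin m → Bool)), (∀ i, IsDegLeFun 2 fun x => π x i) →
    (∀ i, IsDegLeFun 2 fun x => π.symm x i) →
      ∃ ℓ : Fin m → Bool, ℓ ≠ (fun _ => false) ∧ IsDegLeFun 1 fun x => dotB ℓ (π x)

/-- **Refutation of the strengthening** (`m = 3`, the Gold cube; landed lemma). -/
theorem not_biquadraticPermsHaveAffineComponent : ¬ BiquadraticPermsHaveAffineComponent := by
  intro h
  obtain ⟨π, hq, hqi, hno⟩ := exists_biquadratic_perm_without_affine_component
  obtain ⟨ℓ, hℓ, haff⟩ := h 3 π hq hqi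
  exact hno ℓ hℓ haff

end Biquadratic

/-! #### §3c The partner is replaceable: cross-correlation identity, sign transport, an easy sub-family

LANDED: `Theorems/SignedCubicForrelationInPrBPP/Negative/CrossCorrelation.lean` (p71730) — `fsum_comm`,
`fsum_mul_cross_eq` (`S(f,g)·⟨f,g'⟩ = 2ⁿ·S(g',g)` for an exact pair and ANY real `g'`), `fsum_mul_cross_eq'`
(slots swapped), `forrelation_mul_cross_eq`, `forrelation_eq_sign_cross_mul_sign`, `abs_cross_eq`.
Consequences (prose; the algorithmic steps are not formalised):
* SIGN TRANSPORT: `sgn Φ(f,g) = sgn⟨f,g'⟩ · sgn Φ(g',g)` whenever `⟨f,g'⟩ ≠ 0`; `⟨f,g'⟩ = ∑_x (-1)^{f+g'}`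
  is samplable to `± 2ⁿ/poly`, so the signed problem for `(f,g)` reduces to the signed problem for
  `(g',g)` for ANY `g'` with `|Φ(g',g)| = |⟨f,g'⟩|/2ⁿ ≥ 1/poly`: the partner carries no information beyond
  "what it is correlated with".
* EASY SUB-FAMILY: for QUADRATIC `g'`, `W_{g'}` is a signed quadratic Gauss sum on a flat (Dickson), so
  `Φ(g',g) = 2^{-k/2}·bias_flat(g + g'^*)` is samplable as well: every exact cubic pair in which EITHER
  half (slots are symmetric) has a quadratic approximant of correlation `≥ ε` is decided classically in
  randomised `poly(n,1/ε)` time once the approximant is known, and for constant `ε` the algorithmic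
  `U³`-inverse theorem (Tulsiani–Wolf 2011, arXiv:1105.4372) finds one.
* HENCE hardness of the sign can only live on pairs BOTH of whose halves have second-order nonlinearity
  `2^{n-1}(1 - o(1))`; for MM templates `b = u·π(v) + h(v)` this excludes every `π` (and `π⁻¹`) with
  non-negligible affine agreement `max_{L,c} Pr_v[π(v) = Lv + c]`.
* REFUTED STRENGTHENING implicit here: "the sign needs the full ANF of the partner" — one samplable bit
  `sgn⟨f,g'⟩` per usable anchor `g'` suffices. -/

section Cross

open Summit.QuantumAdvantage.QuantumAdvantage.Theorems.SignedCubicForrelationInPrBPP.Negative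
  (forrelation_eq_sign_cross_mul_sign abs_cross_eq)

variable {m : ℕ}

/-- Sign transport (alias of the landed theorem, kept here for the index). -/
theorem sign_transport (f g g' : (Fin m → Bool) → Bool) (hΦ : forrelation f g ^ 2 = 1)
    (hc : ∑ x, signOf (f x) * signOf (g' x) ≠ 0) :
    forrelation f g = Real.sign (∑ x, signOf (f x) * signOf (g' x)) * Real.sign (forrelation g' g) :=
  forrelation_eq_sign_cross_mul_sign f g g' hΦ hc

/-- Usability of an anchor: `|⟨f,g'⟩| = 2ⁿ |Φ(g',g)|` (alias of the landed theorem). -/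
theorem anchor_usable_iff (f g g' : (Fin m → Bool) → Bool) (hΦ : forrelation f g ^ 2 = 1) :
    |∑ x, signOf (f x) * signOf (g' x)| = (2 : ℝ) ^ m * |forrelation g' g| :=
  abs_cross_eq f g g' hΦ

end Cross

/-! #### §3d Where a hard family for `X` could live (prose; = where a proof of `S` must work hardest)

STATE OF THE ROUTE (read 2026-08-16T05:30Z): `CubicStability` (r2, stmt-2202) is REFUTED
(`Theorems.CubicStabilityRefutation.cubicStability_refuted`, witness P₄, n = 12, Φ = 625/1024, no bent function within
2ⁿ/4 of b); it is replaced by `NearExactIsExact` (stmt-14043: ∃ θ < 1, Φ > θ ⇒ Φ = 1), whose own disprover has moved the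
constant to `θ ≥ 15/16` (Φ = 15/16 attained at n = 16 by a biquadratic-up-to-one-flat `π`; MM ceiling 31/32 on paper;
`Cruxes/NearExactIsExact/Disproof.lean`). The unsigned rung r4 `CubicForrelationInPrBPP` is PROVED formally
(`Theorems.CubicForrelationInPrBPP_proof`, the Φ²-estimator machine) — so `S` = [|Φ| ≥ 3/5, classical theorem] + [sign].
Eight idea cards, triage r1 (6 pass), three lines filed (`Lines/{polar_radical_seeds,seed_to_sign,transpose_defect_locator}.lean`).

CONVERGENCE: the structure behind §3c/K7 of this file is the ideator-2 card `dual-pair-meataxe-anchor`: for an exact MM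
pair in public coordinates (b′ = b∘M, a′ = ã∘M^{-T}), with A₀ the M-subspace of b′ (A₀^⊥ that of a′),
(A) T_{b′}(A₀, V, ·) ⊆ A₀^⊥ and (B) T_{a′}(A₀^⊥, V, ·) ⊆ A₀, T_{a′}(A₀^⊥, A₀^⊥, ·) = 0, so every operator
L_{v,η}(δ) = T_{a′}(T_{b′}(δ,v,·)♯, η, ·)♯ preserves A₀ (module handle, MeatAxe), the quadratic forms
E_{w,w′,z}(δ) = T_{a′}(T_{b′}(δ,w,·)♯, T_{b′}(δ,w′,·)♯, z) vanish on A₀ (relinearisation handle — a FILTER only: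
rank-deficient, ideator kit j007785; this seat's Λ²-form K7 = j007844 measures the same span), and the alternating
closure amplifies seeds. Collected constraints on exact cubic pairs `(b̃ ⊕ c, b)` that could still defeat classical
sign-finding — equivalently, the standing TARGETS of this seat (the cards' named killers):
1. (definition) `b` cubic bent with CUBIC dual; on the MM# orbit: `π` AND `π⁻¹` quadratic, `deg(h∘π⁻¹) ≤ 3`.
2. (§3a) any decider must break the complement symmetry explicitly; statistics even in `b` are useless.
3. (§3c) BOTH halves need second-order nonlinearity `2^{n-1}(1-o(1))`: negligible affine agreement of `π`, `π⁻¹`.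
4. (§3b + sibling FlatSign / the lines' finders) KILLER (γ): a biquadratic `π` NOT affinely a shear
   (`(u,v) ↦ (u, v + Q(u))`; shears have `𝒜 = 0` and are the Rad-peel's regime) with `𝒜 = ⟨L_{v,η}⟩ = 0`;
   KILLER (β): an exact cubic pair with `Rad T_b = Rad T_a = 0` on which the module/closure handles give no certified
   A₀ (submodule zoo without assembly, or `𝒜 = 0`). Census under way: kit j013978 (ALL biquadratic classes of 𝔽₂³, 𝔽₂⁴;
   bi-triangular and Gold-sum families m = 6, 8). Direct sums are excluded as a source (centroid decomposition; the
   module is block-diagonal), triangular maps with affine levels are the peel's (affine components), so an indecomposable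
   non-triangularisable biquadratic `π` beyond the Gold cube is needed in growing dimension — existence OPEN.
5. (2205's disprover) every cubic-dual completion class met so far is a GL-image of a sparse MM form; a pair OUTSIDE
   MM# needs a cubic bent function with cubic dual outside MM# (none known; PP20's `h^10_3, h^10_4` have quartic duals;
   whether those quartic duals are `0.2·2ⁿ`-close to a cubic — non-MM# bent halves in the BAND — is kit j007575/j007773).
6. CAUTIONARY ANALOGY (evidence for `S`): schemes hiding the algebraic structure of a low-degree IQP phase polynomial
   behind linear mixing were classically broken by secret extraction — Kahanamoku-Meyer (arXiv:1912.05547, the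
   Shepherd–Bremner QRC test) and Gross–Hangleiter (arXiv:2312.10156, obfuscated IQP circuits). A hard family for `X`
   is an obfuscation claim of exactly this kind, and the cards' finders are secret-extraction attacks of the same type.

PAPER ANALYSIS of the killers (this seat, 2026-08-16; hidden MM coordinates, all statements coordinate-free):
(R) `Rad T_b = {(ℓ, z) : z ∈ LS(π), Σᵢ ℓᵢ B_{πᵢ} = T_{h₃}(z,·,·)}` where `LS(π) = ∩ᵢ Rad B_{πᵢ}` = the linear structures of
    `π` (v-part) and, for `z = 0`, `ℓ ∈ AffComp(π) = {ℓ : ℓ·π affine}` (`Σ ℓᵢ B_{πᵢ} = 0` iff `ℓ·π` has zero polarisation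
    iff it is affine over 𝔽₂); so `Rad T_b ⊇ AffComp(π) ⊕ 0`, `= AffComp(π) ⊕ LS(π)` when `h₃ = 0`, and in every case
    `Rad T_b = 0` when `π` has neither an affine component nor a linear structure ("nondegenerate"); the same for `a`
    with `ρ = π⁻¹`, and `AffComp(π) ≅ AffComp(ρ)`, `LS(π) ≅ LS(ρ)` (the triage's polar bijection). CHECKED at m = 3
    (j014210): Gold class `rad_b = rad_a = 0`; the class with one affine component `rad = 1`; classes with linear
    structures `rad ≥ 3` and `𝒜 = 0`.
(Z) `𝒜 = 0` iff every `L_{v,η}` vanishes iff `C_b := span{T_b(δ,v,·)♯} ⊆ Rad T_a`. Consequently `𝒜 = 0 ⟹ Rad T_a ⊇ C_b ≠ 0`: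
    the killer "(β) with 𝒜 = 0 and both radicals trivial" CANNOT EXIST, and any (γ) instance (`𝒜 = 0`, `π` not a shear)
    has `LS(ρ) ⊇` the α-part and `AffComp(ρ) ⊇` the β-part of `C_b` — many linear structures AND affine components, i.e.
    it lies in the Rad-peel's regime. The ONLY live adversarial regime is (β′): nondegenerate `π` (`Rad = 0`, so `𝒜 ≠ 0`)
    whose bi-flat module does not single out `A₀` — see §3e for the census of where such `π` can exist at all.
    CHECKED at m = 3 (j014210, mini-MeatAxe over 120 random algebra elements): for the Gold pair (27 non-zero
    generators, `L(A₀) ⊆ A₀` with 0 violations) the ONLY proper submodule ever found is `A₀` (dims {3: 315, 6: 35}) —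
    the lattice is `{0, A₀, V}` and every seed's closure reaches `A₀`; for the degenerate class with an affine component
    (13 generators) the zoo appears (dims {1: 120, 2: 213, 6: 20}), `A₀` is never produced and closures stall at dim 2 —
    exactly the peel's regime. -/

/-! #### §3e Small models and computations (kit; prose index — numbers, not adjectives)

* n = 4 EXHAUSTIVE (j007786): among the 2¹⁵ × 2¹⁵ cubic pairs there are 8 341 376 YES pairs; the value set of
  `Φ ≥ 3/5` is EXACTLY `{5/8, 3/4, 1}` (7 372 800 / 967 680 / 896 pairs); every YES pair is within max-Hamming-distance
  `4 = 2ⁿ/4` of an exact `+1` pair (896 at 0, 6 128 640 at 2, 2 211 840 at 4) — the refuted CubicStability holds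
  trivially at n = 4; the first sporadic values (13/16 at n = 8, 625/1024 at n = 12, 7/8, 15/16) need n ≥ 8.
* PP20 DUALS (j007575): `h⁶₁, h⁸₁, h⁸₂` (homogeneous cubic bent, n = 6, 8) have CUBIC duals — explicit exact pairs with a
  homogeneous half; all n = 10, 12 examples (incl. the non-MM# `h¹⁰₃, h¹⁰₄`) have QUARTIC duals, and Reed-decoding +
  hill-climbing finds no cubic within `0.2·2ⁿ` of the duals of `h¹⁰₁…₄` (upper bounds 400/336/288/396 vs 204.8; only
  `nl₃ ≥ 64` is rigorous): no evidence that a non-MM# bent half enters the band through its own dual. `h¹²₁` (MM#):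
  `nl₃(dual) ≤ 480 = 0.117·2¹²`, a band instance at `Φ ≈ 0.77` with a quartic-dual MM# half (dual-value-sampler regime).
* BENT NEIGHBOURS of the non-MM# functions (K4, j014084; all 50 781 720 codimension-3 flats `A` of 𝔽₂¹⁰, `g₀ = h ⊕ 1_A`):
  `h¹⁰₄` has 36 cubic bent neighbours at distance 128 = d_min(RM(3,10)), `h¹⁰₃` has 4 760; ALL of them have QUARTIC duals —
  no exact cubic pair within the Kasami–Tokura minimum distance of PP20's non-MM# cubics.
* Λ²-LINEARISATION OF THE HIDDEN SPLIT (K7, j007844; 40 instances: bi-triangular / 2-level triangular / Gold-sum `π`,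
  m = 6, 8, 10, coupled GL mixing): the span of the basic forms `T_{b′}(·,·,z)` plus ALL polarised `E_{w,w′,z}` has rank
  `≤ 12` (Gold sums: 12 = n; triangular families 3–10) against the `(3m²−m)/2 = 51/92/145` needed; the annihilator has
  dimension `≥ 54 ≫ C(m,2)`; `A₀` recovered in 0/40. Independent confirmation of the ideator's j007785: relinearisation is a
  FILTER, not a solver; the information is in the MODULE structure (MeatAxe handle), not in the quadratic system.
* LITERATURE CENSUS of biquadratic permutations (quadratic with quadratic inverse) — the object every MM# hardness
  candidate needs NONDEGENERATE (no affine component, no linear structure; §3d (R)): m = 3: the Gold cube (§3b);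
  m = 4: kit j013768 (pending); m = 5: Božilov–Bilgin–Şahin, ToSC 2017(1) 398–404, Table 1 — exactly 18 of the 75 affine
  classes of quadratic 5-bit permutations have quadratic inverses and ALL 18 have `λ = 16`, i.e. an AFFINE COMPONENT
  (14 of them also a linear structure): NO nondegenerate biquadratic permutation of 𝔽₂⁵ exists; m = 6: De Meyer–Bilgin,
  ToSC 2019(2) 169–192, Tables 13–15 — 70 of 2 263 classes have quadratic inverses, 106 classes are nondegenerate
  (Lin < 32, Diff < 64), the 8 "strong" ones (Diff 4, Lin 8) all have CUBIC inverses (computed here from Table 15), and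
  `x³ ⊕ x³` is one nondegenerate biquadratic class; whether any OTHER of the 70 is nondegenerate needs the authors' list
  (acq-05758). So the live regime (β′) of §3d starts at m ≥ 6 and, for an asymptotic family, needs indecomposable
  nondegenerate biquadratic `π` in unbounded dimension — no construction is known (power maps fail: `x⁵, x¹⁷` on 𝔽₆₄ and
  all Gold maps beyond 𝔽₈ have inverses of degree ≥ 3). -/

/-! ### §4 Targets — line `polar-radical-seeds` PICKED (PICKED.md 2026-08-16T05:37Z); stub-by-stub assessment

Skeleton `Lines/polar_radical_seeds.lean` (lead prover-line-stmt-QuantumAdvantage-13933-0): 7 registered stubs, composition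
`SignedCubicForrelationInPrBPP_of` sorry-free ⇒ NO smuggled gap (the stubs as stated DO give the crux). Verdicts:
* `stub_heredity` — TRUE (paper, re-derived here): `e ↦ T ξ e` maps `E` into `Ann(E + R_ξ)` using ONLY the two stated
  symmetries and `T(E,E,·) = 0` (no alternating hypothesis needed: `T(ξ,e,w) = T(e,w,ξ) = 0` for `e,w ∈ E`, and
  `T(ξ,e,w) = T(ξ,w,e) = 0` for `w ∈ R_ξ`); kernel `E ∩ R_ξ`; rank–nullity + `dim(E+R)+dim(E∩R) = dim E + dim R` +
  `n ≤ 2 dim E` give `dim R_ξ ≤ 2 dim(E ∩ R_ξ)`. Nothing to attack.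
* `stub_dualValue` — TRUE (paper): on a coset `z ⊕ V` where `g` is affine with linear part `λ`, `Σ_v (-1)^{g+x·}` is
  `|V|·[x|_V = λ]·(-1)^{g z + x·z}`, so `W_g(x) = Σ_{z ≡ x}(-1)^{g z + x·z}`; (b) matches of `z` = a coset of `V^⊥`. Any
  `V` (no half-dimension, no bentness). Nothing to attack.
* `stub_certify` — TRUE (paper): `D_r D_s g` has degree `≤ 1` for cubic `g`; an affine function vanishing at `0` and the
  unit vectors is `0`; extend to the span by `D_{u⊕u′}D_v g(y) = D_uD_v g(y) ⊕ D_{u′}D_v g(y ⊕ u)`.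
* `stub_passThrough` — TRUE (textbook union bound `1/10 + 1/10 < 1/3` in the four cases; needs the two coin blocks).
* `stub_safeMM` — closed mathematics given its three hypotheses (soundness of the certificate ⇒ it never answers wrongly
  with probability `> 1/72 + …`; completeness via the finder on the swapped instance, `Φ` symmetric); XL plumbing only.
* `stub_finder` (OPEN, ∈ FP-claim, unrefutable by a finite witness) — the adversary's content is KILLER INSTANCES: by §3d
  (R)/(Z) the finder's hard case is NONDEGENERATE biquadratic `π` (all first polar radicals informative but no affine
  component / linear structure to peel) in growing dimension, plus MM-type NON-bijective quadratic `π` whose trilinear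
  form dies on large subspaces (recursion bottoms out in `T ≡ 0` regions where only the quadratic part distinguishes
  `E ∩ W`). Census/hunt: §3e (m = 3 Gold only; m = 5 none; m = 4 j014210; m = 6, 7 SAT hunt j014460 — first m = 6
  solutions all have the `x³ ⊕ x³` profile: Diff 16, rank profile {2:14, 4:49}).
* `stub_residue` (OPEN, sub-promise of the crux, unrefutable) — NOT VACUOUS: the landed P₄ witness
  (`Theorems/CubicStability/Negative/P4Witness.lean`, `fA, gB`, n = 12, cubic, `Φ = 625/1024`) has NO half-dimensional
  M-subspace on either side — PROVED sorry-free in `Theorems/SignedCubicForrelationInPrBPP/Negative/ResidueNonempty.lean`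
  (proposal p84971; blockwise second differences constant ⇒ block projections pairwise dependent ⇒ `|V| ≤ 16 < 64`). By
  §2b gluing, residue instances exist at every even `n ≥ 12` with M-defect 2; an UNBOUNDED-defect residue family would
  need residue blocks with `Φ → 1`, i.e. a non-MM counterexample mechanism to `NearExactIsExact` (θ ≥ 15/16 so far), or
  genuinely indecomposable residue instances (none known). -/

/-! ### §5 Near-miss: the crux itself -/

/-- NEAR-MISS (cannot close). Obstruction: by `not_crux_iff_target` this is the route's thesis `X`,
an explicit `PromiseBQP ⊄ PromiseBPP'` witness (§1), i.e. a `P ≠ PP`-strength separation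
(`not_crux_imp_P_ne_PP`, `SeparationPrerequisites`). Tried: formal-glitch audit of `PromiseBPP'`,
`uniformProb`, `encode` (injective), promise disjointness/inhabitation — all clean (3 refuter passes);
vacuity/degenerate `n = 0, 2` — inside the promise and harmless; no finite computation bears on an
asymptotic membership claim. What WOULD settle it negatively is conditional only: a Karp reduction
TO `signedCubicForrelationProblem 2` from a problem believed outside `PromiseBPP'`
(`mem_PromiseBPP'_of_polyTimeReducible_holds` then gives `S → that problem ∈ PromiseBPP'`); the
natural source is hidden-structure hardness of cubic bent/dual pairs (MinRank/IP1S-type), for which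
no completeness result is known. -/
theorem crux_refuted : ¬ SignedCubicForrelationInPrBPP := by
  sorry

end Summit.QuantumAdvantage.QuantumAdvantage.Cruxes.SignedCubicForrelationInPrBPP.Disproof
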